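import Summits.QuantumFields.YangMills.Theorems.BalabanUVNodesN15KingModelComplexLinkHeatKernel
import HarnessLib
/-!
# BalabanUVNodes ∕ N15 — THE KING-MODEL RUNG (PART Ϛ-p): THE DECAY RATE OF THE COMPLEXIFIED HEAT KERNEL — King's heat kernel has row sums `e^{−tm′²}` EXACTLY, so on the polydisc
# `Σ_y‖(e^{−tM_{U,V}})_{xy}‖_{op} ≤ e^{−t(m² − 2(d+1)cε)}`: the complexified semigroup is an `ℓ^∞` contraction decaying at rate `m′² = m² − 2(d+1)cε`, exponentially stable EXACTLY when the window
# inequality `2(d+1)cε < m²` holds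
# (Track A, DAG node N15 = NE2; FAN-OUT v1.1 §N15 s3 «KING-MODEL RUNG … + what the curved case adds»; count-neutral)
HONEST FRAMING.  Count-neutral (cell `pub-ymgap`, seat `pub-ymgap-dag-n15-e` g43; `--supports stmt-QuantumFields-27247 --as helper` = K3ᴬ, KEY MAP v3).  One finite torus at fixed
spacing; King's `A = 0` model, FINE covariance layer only; nothing of Bałaban's (3.42) ∕ Thm 3.4 for `G(U)` asserted; nothing continuum ∕ ℝ⁴ ∕ OS ∕ Clay; NOT a node discharge.
WHAT IS DECIDED.  PART Ϛ-o gave `‖(e^{−tM_{U,V}})_{xy}‖_{op} ≤ (e^{−tL′})(x,y)`, `L′ = lapF K ((1+ε)c) m′²`.  King's `L′` has the constants as exact eigenvector (row sums of `T′` are `2(d+1)(1+ε)c`,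
Ͱ-k `sum_kingHop_pow_row`), so its heat kernel has row sums `e^{−tm′²}`:
* §1 ★★ `sum_exp_smul_kingHop_row` (`Σ_y(e^{tT′})(x,y) = e^{2(d+1)c′t}`), ★★ **`sum_exp_neg_lapF_shifted_row`** (`Σ_y(e^{−tL′})(x,y) = e^{−tm′²}`), ★ `exp_neg_lapF_shifted_apply_le` (each entry `≤ e^{−tm′²}`);
* §2 ★★★ **`sum_l2_opNorm_blk_exp_neg_cxLapF_le`** — on the polydisc (`c ≥ 0`, `t ≥ 0`, `‖U(b)‖,‖V(b)‖ ≤ 1+ε`): `Σ_y‖(e^{−tM_{U,V}})_{xy}‖_{op} ≤ e^{−t(m²−2(d+1)cε)}` — THE COMPLEXIFIED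
  SEMIGROUP IS AN `ℓ^∞`-CONTRACTION WITH RATE `m′²`; ★★ `l2_opNorm_blk_exp_neg_cxLapF_le_exp` (every block `≤ e^{−tm′²}`); ★★ `sum_l2_opNorm_blk_exp_neg_covLapF_le` ∕ `l2_opNorm_blk_exp_neg_covLapF_le_exp`
  (unitary `U`, `ε = 0`: rate `m²` — [DM06]'s `λ₀(Δ_σ) ≥ λ₀(Δ)` in semigroup form on King's torus);
* §3 ★★ **`tendsto_blk_exp_neg_cxLapF`** — INSIDE THE WINDOW (`2(d+1)cε < m²`) the complexified heat kernel tends to `0` as `t → ∞`, uniformly dominated by `e^{−tm′²}` (so `G_{U,V} = ∫₀^∞e^{−tM}dt`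
  would converge; the proper-time identity itself is not typed here).  At the edge `ε⋆` of PART Ϛ-d the rate is `0` (the constants are annihilated), matching the sharpness.
PRIOR TREE ART (by name): Ϛ-o (`exp_scalar_split`, `hasSum_exp_smul_kingHop_apply`, `exp_smul_kingHop_apply_nonneg`, `lapF_shifted_eq_diagonal_sub`, `l2_opNorm_blk_exp_neg_cxLapF_le`), Ϛ-b (`shifted_D0`,
`shifted_weight_nonneg`, `shifted_mass_pos`, `unitary_mem_window`), Ͱ-k (`sum_kingHop_pow_row`), Ϛ-a (`cxLapF_adjoint`), Mathlib (`hasSum_sum`, `NormedSpace.exp_series_hasSum_exp'`, `Real.exp_eq_exp_ℝ`,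
`Real.exp_add`, `Real.tendsto_exp_neg_atTop_nhds_zero`, `squeeze_zero_norm'`).  Dedup (rg at filing): basename 0 files; needles `exp_neg_lapF_shifted_row|exp_neg_cxLapF_le_exp|tendsto_blk_exp` 0
tree files.  Locators: [DodziukMathai2006] Thm 1.5 + Cor 1.3 §1; [Balaban1985BackgroundPropagators] Thm 3.4 p.400; [King1986] (4.4) p.670.  0 `sorry`, 0 `def`.
-/

noncomputable section
open scoped BigOperators ComplexConjugate ComplexOrder Topology Matrix.Norms.L2Operator
open Finset Matrix Filter

namespace Summit.QuantumFields.YangMills.BalabanUVNodes.N15KingModelRung.Covariant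

open Literature.MathematicalPhysics.QuantumFieldTheory.LatticeDiamagneticInequality (Hopping blk)
open Literature.MathematicalPhysics.QuantumFieldTheory.Balaban1983to89.B5Prop11Plancherel (Tor unitVec)
open Literature.MathematicalPhysics.QuantumFieldTheory.King1986.Torus (lapF)

variable {d : ℕ} (K : Fin (d + 1) → ℕ) [hK : ∀ μ, NeZero (K μ)]
variable {𝕜 : Type*} [RCLike 𝕜] {n : Type*} [Fintype n] [DecidableEq n] {c m2 ε : ℝ}

/-! ## §1 Row sums of King's heat kernel -/

/-- ★★ ROW SUMS OF THE HOPPING SEMIGROUP: `Σ_y(e^{tT′})(x,y) = e^{2(d+1)c′·t}` (the constants are an eigenvector of `T′` with eigenvalue `2(d+1)c′`). [cite: King1986, (4.4) p.670] -/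
theorem sum_exp_smul_kingHop_row (c' t : ℝ) (x : Tor K) :
    ∑ y, (NormedSpace.exp (t • kingHop K c')) x y = Real.exp (t * (2 * ((d : ℝ) + 1) * c')) := by
  have hsum : HasSum (fun k : ℕ => ∑ y, ((k.factorial : ℝ))⁻¹ * t ^ k * (kingHop K c' ^ k) x y) (∑ y, (NormedSpace.exp (t • kingHop K c')) x y) :=
    hasSum_sum fun y _ => hasSum_exp_smul_kingHop_apply K c' t x y
  have hrow : ∀ k : ℕ, ∑ y, ((k.factorial : ℝ))⁻¹ * t ^ k * (kingHop K c' ^ k) x y = ((k.factorial : ℝ))⁻¹ • (t * (2 * ((d : ℝ) + 1) * c')) ^ k := fun k => by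
    rw [← Finset.mul_sum, sum_kingHop_pow_row, smul_eq_mul, mul_assoc, ← mul_pow]
  simp only [hrow] at hsum
  have hexp : HasSum (fun k : ℕ => ((k.factorial : ℝ))⁻¹ • (t * (2 * ((d : ℝ) + 1) * c')) ^ k) (Real.exp (t * (2 * ((d : ℝ) + 1) * c'))) := by
    rw [Real.exp_eq_exp_ℝ]
    exact NormedSpace.exp_series_hasSum_exp' (𝕂 := ℝ) _
  exact hsum.unique hexp

/-- ★★ **ROW SUMS OF KING's HEAT KERNEL AT THE SHIFTED PARAMETERS**: `Σ_y(e^{−t·lapF K ((1+ε)c) (m²−2(d+1)cε)})(x,y) = e^{−t(m²−2(d+1)cε)}` for every `t` (the constants are an exact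
eigenvector with eigenvalue `m′²`). [cite: King1986, (4.4) p.670, (2.17) p.653] -/
theorem sum_exp_neg_lapF_shifted_row (c m2 ε t : ℝ) (x : Tor K) :
    ∑ y, (NormedSpace.exp (-(t • lapF K ((1 + ε) * c) (m2 - 2 * ((d : ℝ) + 1) * c * ε)))) x y = Real.exp (-(t * (m2 - 2 * ((d : ℝ) + 1) * c * ε))) := by
  have h := exp_scalar_split (𝕜 := ℝ) (kingHop K ((1 + ε) * c)) t (m2 + 2 * ((d : ℝ) + 1) * c)
  simp only [RCLike.ofReal_real_eq_id, id_eq] at h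
  rw [lapF_shifted_eq_diagonal_sub, h]
  simp only [Matrix.smul_apply, smul_eq_mul, ← Finset.mul_sum]
  rw [sum_exp_smul_kingHop_row, ← Real.exp_add]
  congr 1
  ring

/-- ★ EVERY ENTRY OF KING's HEAT KERNEL IS `≤ e^{−tm′²}` (`t ≥ 0`, `c ≥ 0`, `ε ≥ 0`; entries are non-negative, rows sum to `e^{−tm′²}`). [cite: King1986, (4.4) p.670] -/
theorem exp_neg_lapF_shifted_apply_le (hc : 0 ≤ c) (hε : 0 ≤ ε) {t : ℝ} (ht : 0 ≤ t) (x y : Tor K) :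
    (NormedSpace.exp (-(t • lapF K ((1 + ε) * c) (m2 - 2 * ((d : ℝ) + 1) * c * ε)))) x y ≤ Real.exp (-(t * (m2 - 2 * ((d : ℝ) + 1) * c * ε))) := by
  rw [← sum_exp_neg_lapF_shifted_row K c m2 ε t x]
  exact Finset.single_le_sum (fun z _ => exp_neg_lapF_shifted_apply_nonneg K (m2 := m2) hc hε ht x z) (Finset.mem_univ y)

/-! ## §2 The complexified semigroup is an `ℓ^∞`-contraction with rate `m′²` -/

/-- ★★★ **THE COMPLEXIFIED SEMIGROUP IS AN `ℓ^∞`-CONTRACTION WITH RATE `m² − 2(d+1)cε`**: for `c ≥ 0`, `ε ≥ 0`, `t ≥ 0` and every two-sided field with `‖U(b)‖, ‖V(b)‖ ≤ 1+ε`: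
`Σ_y‖(e^{−tM_{U,V}})_{xy}‖_{op} ≤ e^{−t(m²−2(d+1)cε)}` — decaying when the window inequality `2(d+1)cε < m²` holds, constant at the edge, growing beyond.
[cite: DodziukMathai2006, Thm 1.5 §1; Balaban1985BackgroundPropagators, Thm 3.4 p.400; King1986, (4.4) p.670] -/
theorem sum_l2_opNorm_blk_exp_neg_cxLapF_le (hc : 0 ≤ c) {t : ℝ} (ht : 0 ≤ t) {U V : Tor K × Fin (d + 1) → Matrix n n 𝕜}
    (hU : ∀ b, ‖U b‖ ≤ 1 + ε) (hV : ∀ b, ‖V b‖ ≤ 1 + ε) (x : Tor K) :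
    ∑ y, ‖blk (NormedSpace.exp (-((((t : ℝ) : 𝕜)) • cxLapF K c m2 U V))) x y‖ ≤ Real.exp (-(t * (m2 - 2 * ((d : ℝ) + 1) * c * ε))) := by
  rw [← sum_exp_neg_lapF_shifted_row K c m2 ε t x]
  exact Finset.sum_le_sum fun y _ => l2_opNorm_blk_exp_neg_cxLapF_le K hc ht hU hV x y

/-- ★★ EVERY BLOCK OF THE COMPLEXIFIED HEAT KERNEL IS `≤ e^{−tm′²}` on the polydisc. [cite: DodziukMathai2006, Thm 1.5 §1; Balaban1985BackgroundPropagators, Thm 3.4 p.400] -/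
theorem l2_opNorm_blk_exp_neg_cxLapF_le_exp (hc : 0 ≤ c) (hε : 0 ≤ ε) {t : ℝ} (ht : 0 ≤ t) {U V : Tor K × Fin (d + 1) → Matrix n n 𝕜}
    (hU : ∀ b, ‖U b‖ ≤ 1 + ε) (hV : ∀ b, ‖V b‖ ≤ 1 + ε) (x y : Tor K) :
    ‖blk (NormedSpace.exp (-((((t : ℝ) : 𝕜)) • cxLapF K c m2 U V))) x y‖ ≤ Real.exp (-(t * (m2 - 2 * ((d : ℝ) + 1) * c * ε))) :=
  (l2_opNorm_blk_exp_neg_cxLapF_le K hc ht hU hV x y).trans (exp_neg_lapF_shifted_apply_le K hc hε ht x y)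

/-- ★★ **AT A UNITARY FIELD (ε = 0) THE RATE IS `m²`**: `Σ_y‖(e^{−t(−cΔ_U+m²)})_{xy}‖_{op} ≤ e^{−tm²}` for every unitary `U`, `t ≥ 0` — [DM06]'s `λ₀(Δ_σ) ≥ λ₀(Δ)` in semigroup form on King's
torus. [cite: DodziukMathai2006, Thm 1.5 §1, Cor 1.3; King1986, (4.4) p.670] -/
theorem sum_l2_opNorm_blk_exp_neg_covLapF_le (hc : 0 ≤ c) (m2 : ℝ) {t : ℝ} (ht : 0 ≤ t) {U : Tor K × Fin (d + 1) → Matrix n n 𝕜}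
    (hU : ∀ b, U b ∈ Matrix.unitaryGroup n 𝕜) (x : Tor K) :
    ∑ y, ‖blk (NormedSpace.exp (-((((t : ℝ) : 𝕜)) • covLapF K c m2 U))) x y‖ ≤ Real.exp (-(t * m2)) := by
  have h := sum_l2_opNorm_blk_exp_neg_cxLapF_le K (m2 := m2) (ε := 0) hc ht (unitary_mem_window K hU).1 (unitary_mem_window K hU).2 x
  rwa [cxLapF_adjoint, mul_zero, sub_zero] at h

/-- ★★ … and every block `≤ e^{−tm²}` at a unitary field. [cite: DodziukMathai2006, Thm 1.5 §1; King1986, (4.4) p.670] -/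
theorem l2_opNorm_blk_exp_neg_covLapF_le_exp (hc : 0 ≤ c) (m2 : ℝ) {t : ℝ} (ht : 0 ≤ t) {U : Tor K × Fin (d + 1) → Matrix n n 𝕜}
    (hU : ∀ b, U b ∈ Matrix.unitaryGroup n 𝕜) (x y : Tor K) :
    ‖blk (NormedSpace.exp (-((((t : ℝ) : 𝕜)) • covLapF K c m2 U))) x y‖ ≤ Real.exp (-(t * m2)) := by
  have h := l2_opNorm_blk_exp_neg_cxLapF_le_exp K (m2 := m2) hc le_rfl ht (unitary_mem_window K hU).1 (unitary_mem_window K hU).2 x y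
  rwa [cxLapF_adjoint, mul_zero, sub_zero] at h

/-! ## §3 Inside the window the complexified heat kernel tends to zero -/

/-- ★★ **INSIDE THE WINDOW THE COMPLEXIFIED HEAT KERNEL DECAYS**: for `c ≥ 0`, `0 ≤ ε`, `2(d+1)cε < m²` and `‖U(b)‖, ‖V(b)‖ ≤ 1+ε`, every block `(e^{−tM_{U,V}})_{xy} → 0` as `t → ∞`
(dominated by `e^{−tm′²}`, `m′² > 0`). [cite: Balaban1985BackgroundPropagators, Thm 3.4 p.400; DodziukMathai2006, Thm 1.5 §1] -/
theorem tendsto_blk_exp_neg_cxLapF (hc : 0 ≤ c) (hε : 0 ≤ ε) (hwin : 2 * ((d : ℝ) + 1) * c * ε < m2) {U V : Tor K × Fin (d + 1) → Matrix n n 𝕜}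
    (hU : ∀ b, ‖U b‖ ≤ 1 + ε) (hV : ∀ b, ‖V b‖ ≤ 1 + ε) (x y : Tor K) :
    Tendsto (fun t : ℝ => blk (NormedSpace.exp (-((((t : ℝ) : 𝕜)) • cxLapF K c m2 U V))) x y) atTop (𝓝 0) := by
  have hm' := shifted_mass_pos hwin
  have hexp : Tendsto (fun t : ℝ => Real.exp (-(t * (m2 - 2 * ((d : ℝ) + 1) * c * ε)))) atTop (𝓝 0) := by
    have h1 : Tendsto (fun t : ℝ => t * (m2 - 2 * ((d : ℝ) + 1) * c * ε)) atTop atTop := tendsto_id.atTop_mul_const hm'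
    exact Real.tendsto_exp_neg_atTop_nhds_zero.comp h1
  refine squeeze_zero_norm' ?_ hexp
  filter_upwards [eventually_ge_atTop (0 : ℝ)] with t ht
  exact l2_opNorm_blk_exp_neg_cxLapF_le_exp K hc hε ht hU hV x y

end Summit.QuantumFields.YangMills.BalabanUVNodes.N15KingModelRung.Covariant

end
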